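import Literature.NumberTheory.LFunctions.Zhang2022.Section17Lemma171
import Literature.NumberTheory.LFunctions.Zhang2022.RepairGapLemma31ScaleLaw
import HarnessLib

/-!
# Zhang (2022), rescue GAP/REQSIDE (D-0124 (4)–(5)): the SCALE LAW of Lemma 17.1 (Appendix B) —
# `∑_{n<D⁴} ν(n)²/n = 𝔞 + O(𝓛^{−k})` as soon as `‖L(1,χ)‖ ≤ 𝓛^{−(k+5)}` (printed: `2022 ↦ 2011`)

Topic `Literature/NumberTheory/LFunctions/Zhang2022` (Landau–Siegel audit tree; verdict-neutral).
Y. Zhang, *Discrete mean estimates and the Landau–Siegel zero*, arXiv:2211.02515v1 (2022)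
[Zhang2022LandauSiegel] — **an unrefereed manuscript under adjudication; nothing in this file asserts or
denies its Theorems 1–2, and nothing here is a claim about Landau–Siegel zeros. The programme SEARCHES and
TYPES; no claim about Landau–Siegel zeros, Theorems 1–2 of arXiv:2211.02515 or a repaired Margin232 until a
kernel theorem says so.**

Lemma 17.1 (§17 p. 35, proved in Appendix B p. 39: "`∑_{n<D⁴} ν(n)²/n = 𝔞 + o(1)`", `𝔞 = (6/π²)L′(1,χ)²∏_{q∣D}q/(q+1)`
(2.31), under the standing assumption (A) `L(1,χ) < 𝓛^{−2022}`) is the tree theorem `Lemma171.lemma_17_1` (file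
`Section17Lemma171`; rate `𝓛^{−2011}` from the printed exponent `2022`), the Part-III leaf `Skeleton.AppBLemma171`.
Its two uses of (A) are SMALLNESS DOORS (bed-2 FINDINGS v0.20 §19): (i) the smoothing step inserts the weight
`e^{−n/D⁶}` at the cost of the SHORT tail `∑_{D⁴<n≤D⁸} ν(n)²/n`, bounded "by Lemma 3.1" — the case `x = 3` of the
Lemma 3.1 scale law (`Repair.Gap.lemma31_short_tail_of_norm_le`: saving `𝓛^{−k}` from `‖L(1,χ)‖ ≤ 𝓛^{−(k+5)}`);
(ii) the two lower-order terms of the triple-pole residue carry a factor `L(1,χ)`: `‖L(1,χ)‖²·32M_a𝓛²` and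
`‖L(1,χ)‖·64e^{9/2}M_a(1+𝓛)𝓛²` (`Lemma171.norm_residue_sub_le`) — additive, of degree `≤ 3` in `𝓛`. The shifted
line integral is `O(d(D)²D^{−1/2}(1+𝓛)³) = O_k(𝓛^{−k})` for every `k` (`Repair.Gap.aux_logpow_scale`), no (A).

This file re-runs the tree's assembly with the exponent free:

* `lemma171_scale_of_norm_le` — for every natural `k` there is `C = C(k)` with
  `|∑_{n<D⁴} |ν(n)|²/n − 𝔞| ≤ C𝓛^{−k}` for every `D` with `log D ≥ 3` and every primitive quadratic `χ` mod `D`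
  with `‖L(1,χ)‖ ≤ 𝓛^{−(k+5)}` (the binding term is the short tail: `k + 2 + 3`; the residue terms need only `k + 3`);
* `lemma171_scale_complex` — the complex form with `frakAC`;
* `lemma171_scale_of_assumptionAWith` — hence from `Repair.Bed.AssumptionAWith E` for every real `E ≥ k + 5`;
* `appBLemma171_rate_of_assumptionAWith` — the `Skeleton`-shaped eventual statement with rate `ell D^{−k}` under
  `AssumptionAWith E`, `E ≥ k + 5` (the typed node `Skeleton.AppBLemma171` fixes the rate `2011`, i.e. `k = 2011`,
  `E ≥ 2016`; at the §§8–12 minimum premise `E = 15` the available rate is `𝓛^{−10}`).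

READING (GAP G-31, as-typed): Lemma 17.1 consumes (A) at exponent `k + 5` for a rate `𝓛^{−k}` — LESS than the
printed Lemma 3.1 (`k + 11`), because only the tail up to `D⁸ ≤ exp(2𝓛³)`, not up to `P² = exp(2𝓛⁹)`, is inserted.
Sufficiency only; theorems only; no definition, no named fact; nothing about (A) itself is asserted.

## References

* Y. Zhang, arXiv:2211.02515v1 (2022), §17 Lemma 17.1 (p. 35); Appendix B "Proof of Lemma 17.1" (p. 39); §2 (2.31);
  §3 Lemma 3.1. [cite: Zhang2022LandauSiegel, §17, Lemma 17.1; App. B]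
-/

noncomputable section

open Complex Filter Topology Set MeasureTheory Real Metric
open scoped LSeries.notation

namespace Literature.NumberTheory.LFunctions.Zhang2022.Repair.Gap

open Literature.NumberTheory.LFunctions.DivisorSumCharSq (phi W)
open Literature.NumberTheory.LFunctions.Zhang2022.Lemma31 (ne_one_of_isPrimitive divisorSumChar_sq_eq
  eight_lt_exp_three)
open Literature.NumberTheory.LFunctions.Zhang2022.Lemma171
open Literature.NumberTheory.LFunctions.Zhang2022.Repair.Bed (AssumptionAWith)

/-! ## The scale law: rate `𝓛^{−k}` from `‖L(1,χ)‖ ≤ 𝓛^{−(k+5)}` -/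

/-- **Lemma 17.1 with the exponent free (sufficiency).** For every natural `k` there is a constant `C = C(k)`
such that for every `D` with `log D ≥ 3` and every PRIMITIVE Dirichlet character `χ` mod `D` with `χ² = 1` and
`‖L(1,χ)‖ ≤ (log D)^{−(k+5)}`,

  `|∑_{n<D⁴} |ν(n)|²/n − 𝔞| ≤ C (log D)^{−k}`

(`ν(n) = ∑_{d∣n} χ(d)`, `𝔞 = (6/π²)L′(1,χ)²∏_{q∣D} q/(q+1)` = `Lemma171.frakA`). The tree's proof of
`Lemma171.lemma_17_1` verbatim with the printed Lemma 3.1 replaced by the short-tail case `x = 3` of its scale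
law and `D^{−1/2}(1+𝓛)³ ≤ 8·(2(k+3))^{k+3}𝓛^{−k}`; the printed lemma is `k = 2011` (there from `2022 ≥ 2016`).
[cite: Zhang2022LandauSiegel, §17, Lemma 17.1; App. B] -/
theorem lemma171_scale_of_norm_le (k : ℕ) :
    ∃ C : ℝ, ∀ (D : ℕ) [NeZero D] (χ : DirichletCharacter ℂ D),
    χ.IsPrimitive → χ ^ 2 = 1 → 3 ≤ Real.log D →
    ‖χ.LFunction 1‖ ≤ 1 / Real.log D ^ (k + 5) →
      |∑ n ∈ Finset.range (D ^ 4), ‖divisorSumChar χ n‖ ^ 2 / n - frakA χ| ≤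
        C / Real.log D ^ k := by
  obtain ⟨C31, hC31⟩ := lemma31_short_tail_of_norm_le k
  obtain ⟨Cd, hCd1, hCd⟩ := Sieve.exists_card_divisors_le_mul_rpow' (by norm_num : (0 : ℝ) < 1 / 8)
  refine ⟨C31 + 1154 * Cd ^ 2 * (8 * (2 * ((k : ℝ) + 3)) ^ (k + 3)) +
    (32 * Ma + 32 * Real.exp (9 / 2) * Ma) +
    2 * 28 ^ 13 * Kline17 * Cd ^ 2 * (8 * (2 * ((k : ℝ) + 3)) ^ (k + 3)), ?_⟩
  intro D _ χ hprim hχ2 hL hA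
  set M : ℝ := (2 * ((k : ℝ) + 3)) ^ (k + 3) with hM
  set M' : ℝ := (28 : ℝ) ^ 13 with hM'
  clear_value M'
  set Lg : ℝ := Real.log D with hLdef
  have hL1 : 1 ≤ Lg := by linarith
  have hL0 : 0 < Lg := by linarith
  have hD0 : D ≠ 0 := by
    rintro rfl; simp [hLdef] at hL; linarith
  have hDpos : (0 : ℝ) < D := by exact_mod_cast Nat.pos_of_ne_zero hD0
  have hD8 : 8 ≤ D := by
    have h1 : Real.exp 3 ≤ Real.exp Lg := Real.exp_le_exp.2 hL
    rw [hLdef, Real.exp_log hDpos] at h1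
    have := eight_lt_exp_three
    exact_mod_cast (show (8 : ℝ) ≤ D by linarith)
  have hD1 : (1 : ℝ) ≤ D := by exact_mod_cast Nat.one_le_iff_ne_zero.2 hD0
  have hχ1 := ne_one_of_isPrimitive χ (by omega) hprim
  -- the parameter `X = D⁶`
  set X : ℝ := (D : ℝ) ^ 6 with hXdef
  have hXpos : 0 < X := by positivity
  have hX1 : 1 ≤ X := one_le_pow₀ hD1
  have hXL : Real.log X ≤ 6 * Real.log D := by rw [hXdef, Real.log_pow]; push_cast; exact le_rfl
  -- `1/D ≤ (1+𝓛)³/D^{1/2} ≤ 8M/𝓛^{k}`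
  have hlp := aux_logpow_scale k (D := D) hL1 hDpos
  rw [← hLdef, ← hM] at hlp
  have hM0 : 0 ≤ M := by rw [hM]; positivity
  have hDhalf : 0 < (D : ℝ) ^ (1 / 2 : ℝ) := by positivity
  have hinvD : 1 / (D : ℝ) ≤ 8 * M / Lg ^ k := by
    refine le_trans ?_ hlp
    rw [div_le_div_iff₀ hDpos hDhalf, one_mul]
    have h3 : (1 : ℝ) ≤ (1 + Lg) ^ 3 := one_le_pow₀ (by linarith)
    have hh : (D : ℝ) ^ (1 / 2 : ℝ) ≤ D := by
      calc (D : ℝ) ^ (1 / 2 : ℝ) ≤ (D : ℝ) ^ (1 : ℝ) :=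
            Real.rpow_le_rpow_of_exponent_le hD1 (by norm_num)
        _ = D := Real.rpow_one _
    nlinarith
  -- (1) smoothing, the short tail by the Lemma 3.1 scale law at `x = 3`
  have hS := abs_sum_sub_W_re_le χ hχ2 hCd hD1
  have h31 : ∑ n ∈ Finset.Ioc (D ^ 4) (D ^ 8), ‖divisorSumChar χ n‖ ^ 2 / n ≤ C31 / Lg ^ k :=
    hC31 D χ hprim hχ2 hL hA
  have hT1 : |∑ n ∈ Finset.range (D ^ 4), ‖divisorSumChar χ n‖ ^ 2 / n -
      (W (fun n => divisorSumChar χ n ^ 2) X).re| ≤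
      C31 / Lg ^ k + 1154 * Cd ^ 2 * (8 * M) / Lg ^ k := by
    refine hS.trans (add_le_add h31 ?_)
    have hCd0 : 0 ≤ 1154 * Cd ^ 2 := by positivity
    calc 1154 * Cd ^ 2 / (D : ℝ) = 1154 * Cd ^ 2 * (1 / D) := by ring
      _ ≤ 1154 * Cd ^ 2 * (8 * M / Lg ^ k) := mul_le_mul_of_nonneg_left hinvD hCd0
      _ = 1154 * Cd ^ 2 * (8 * M) / Lg ^ k := by ring
  -- (2) the explicit formula `W = Res + (1/2π) ∫`
  have hW := W_eq_residue_add χ hχ2 hχ1 hXpos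
  set Res : ℂ := (Function.swap dslope (0 : ℂ))^[2] (hnum χ X) 0 with hRes
  set Iline : ℂ := ∫ t : ℝ, Fint χ X ((((-(1 / 4) : ℝ)) : ℂ) + t * I) with hIline
  have hπ0 : (π : ℂ) ≠ 0 := ofReal_ne_zero.2 Real.pi_pos.ne'
  have hWeq : W (fun n => divisorSumChar χ n ^ 2) X = Res + (1 / (2 * π)) * Iline := by
    field_simp
    linear_combination hW
  -- (3) the residue is `𝔞` up to `O(𝓛^{-k})`: the two `L(1,χ)`-terms
  have hres := norm_residue_sub_le χ hL hprim hX1 hXL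
  rw [← hRes, phi_one_mul_deriv_sq, ← hLdef] at hres
  have hE := Real.exp_pos (9 / 2)
  have hMa := Ma_nonneg
  have hk5 : Lg ^ (k + 5) = Lg ^ k * Lg ^ 5 := by rw [← pow_add]
  have hL5 : (1 : ℝ) ≤ Lg ^ 5 := one_le_pow₀ hL1
  have hT2 : ‖Res - frakAC χ‖ ≤ (32 * Ma + 32 * Real.exp (9 / 2) * Ma) / Lg ^ k := by
    refine hres.trans ?_
    have hA2 : ‖χ.LFunction 1‖ ^ 2 ≤ (1 / Lg ^ (k + 5)) ^ 2 := pow_le_pow_left₀ (norm_nonneg _) hA 2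
    have p1 : ‖χ.LFunction 1‖ ^ 2 * (32 * Ma * Lg ^ 2) ≤ 32 * Ma / Lg ^ k := by
      calc ‖χ.LFunction 1‖ ^ 2 * (32 * Ma * Lg ^ 2)
          ≤ (1 / Lg ^ (k + 5)) ^ 2 * (32 * Ma * Lg ^ 2) :=
            mul_le_mul_of_nonneg_right hA2 (by positivity)
        _ = 32 * Ma / Lg ^ k * (1 / (Lg ^ k * Lg ^ 5 * Lg ^ 3)) := by
            rw [hk5]; field_simp
        _ ≤ 32 * Ma / Lg ^ k * 1 := by
            gcongr
            rw [div_le_one (by positivity)]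
            exact one_le_mul_of_one_le_of_one_le (one_le_mul_of_one_le_of_one_le (one_le_pow₀ hL1) hL5)
              (one_le_pow₀ hL1)
        _ = 32 * Ma / Lg ^ k := by ring
    have p2 : 2 * ‖χ.LFunction 1‖ *
        (4 * Lg * (Ma * (2 * Real.exp (9 / 2) * (1 + Lg) * Lg))) ≤
        32 * Real.exp (9 / 2) * Ma / Lg ^ k := by
      have h1L : 1 + Lg ≤ 2 * Lg := by linarith
      calc 2 * ‖χ.LFunction 1‖ * (4 * Lg * (Ma * (2 * Real.exp (9 / 2) * (1 + Lg) * Lg)))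
          ≤ 2 * (1 / Lg ^ (k + 5)) * (4 * Lg * (Ma * (2 * Real.exp (9 / 2) * (2 * Lg) * Lg))) := by
            gcongr
        _ = 32 * Real.exp (9 / 2) * Ma / Lg ^ k * (1 / Lg ^ 2) := by
            rw [hk5]; field_simp; ring
        _ ≤ 32 * Real.exp (9 / 2) * Ma / Lg ^ k * 1 := by
            gcongr
            rw [div_le_one (by positivity)]; exact one_le_pow₀ hL1
        _ = 32 * Real.exp (9 / 2) * Ma / Lg ^ k := by ring
    rw [add_div]
    exact add_le_add p1 p2
  -- (4) the shifted integral (no (A))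
  have hT3 : ‖(1 / (2 * (π : ℂ))) * Iline‖ ≤ 2 * M' * Kline17 * Cd ^ 2 * (8 * M) / Lg ^ k := by
    rw [norm_mul]
    have hπ1 : ‖(1 / (2 * (π : ℂ)))‖ ≤ 1 := by
      rw [norm_div, norm_one, norm_mul, Complex.norm_ofNat, Complex.norm_real, Real.norm_eq_abs,
        abs_of_pos Real.pi_pos, div_le_one (by positivity)]
      linarith [Real.pi_gt_three]
    have hI := norm_integral_Fint_line_le χ hprim hD8 hXpos
    rw [← hIline, ← hM', ← hLdef] at hI
    -- the `D`-bookkeeping: `t = D^{1/8}`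
    set t : ℝ := (D : ℝ) ^ (1 / 8 : ℝ) with htdef
    have ht0 : 0 < t := by positivity
    have ht2 : (D : ℝ) ^ (1 / 4 : ℝ) = t ^ 2 := by
      rw [htdef, ← Real.rpow_natCast, ← Real.rpow_mul hDpos.le]; norm_num
    have ht4 : (D : ℝ) ^ (1 / 2 : ℝ) = t ^ 4 := by
      rw [htdef, ← Real.rpow_natCast, ← Real.rpow_mul hDpos.le]; norm_num
    have ht8 : (D : ℝ) = t ^ 8 := by
      rw [htdef, ← Real.rpow_natCast, ← Real.rpow_mul hDpos.le]; norm_num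
    have hX4 : X ^ (-(1 / 4) : ℝ) = 1 / t ^ 12 := by
      have e12 : (1 : ℝ) / t ^ 12 = t ^ (-(12 : ℝ)) := by
        rw [Real.rpow_neg ht0.le, ← Real.rpow_natCast t 12, one_div]; norm_num
      rw [e12, hXdef, ht8, ← pow_mul, ← Real.rpow_natCast, ← Real.rpow_mul ht0.le]
      norm_num
    have hτ : (D.divisors.card : ℝ) ≤ Cd * t := hCd D
    have hτ2 : (D.divisors.card : ℝ) ^ 2 ≤ (Cd * t) ^ 2 := pow_le_pow_left₀ (Nat.cast_nonneg _) hτ 2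
    rw [ht4] at hlp
    have hK := Kline17_pos
    have hM'0 : 0 ≤ M' := by rw [hM']; positivity
    have ht1 : 1 ≤ t := by rw [htdef]; exact Real.one_le_rpow hD1 (by norm_num)
    have h8M : 0 ≤ 8 * M / Lg ^ k := by positivity
    have h1t : 1 / t ^ 4 ≤ 1 := by
      rw [div_le_one (by positivity)]; exact one_le_pow₀ ht1
    have hmain : Kline17 * (D.divisors.card : ℝ) ^ 2 * (D : ℝ) ^ (1 / 4 : ℝ) * (1 + Lg) ^ 3 *
        X ^ (-(1 / 4) : ℝ) ≤ Kline17 * Cd ^ 2 * (8 * M / Lg ^ k) := by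
      calc Kline17 * (D.divisors.card : ℝ) ^ 2 * (D : ℝ) ^ (1 / 4 : ℝ) * (1 + Lg) ^ 3 *
            X ^ (-(1 / 4) : ℝ)
          ≤ Kline17 * (Cd * t) ^ 2 * t ^ 2 * (1 + Lg) ^ 3 * (1 / t ^ 12) := by
            rw [ht2, hX4]; gcongr
        _ = Kline17 * Cd ^ 2 * ((1 + Lg) ^ 3 / t ^ 4 * (1 / t ^ 4)) := by
            field_simp
        _ ≤ Kline17 * Cd ^ 2 * (8 * M / Lg ^ k * 1) := by
            refine mul_le_mul_of_nonneg_left ?_ (by positivity)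
            exact mul_le_mul hlp h1t (by positivity) h8M
        _ = Kline17 * Cd ^ 2 * (8 * M / Lg ^ k) := by ring
    calc ‖(1 / (2 * (π : ℂ)))‖ * ‖Iline‖
        ≤ 1 * (2 * M' * (Kline17 * (D.divisors.card : ℝ) ^ 2 * (D : ℝ) ^ (1 / 4 : ℝ) *
            (1 + Lg) ^ 3 * X ^ (-(1 / 4) : ℝ))) :=
          mul_le_mul hπ1 hI (norm_nonneg _) (by norm_num)
      _ ≤ 1 * (2 * M' * (Kline17 * Cd ^ 2 * (8 * M / Lg ^ k))) := by gcongr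
      _ = 2 * M' * Kline17 * Cd ^ 2 * (8 * M) / Lg ^ k := by ring
  -- (5) combine
  have hAC := frakAC_eq χ hχ1 hχ2
  have hWn : ‖W (fun n => divisorSumChar χ n ^ 2) X - (frakA χ : ℂ)‖ ≤
      (32 * Ma + 32 * Real.exp (9 / 2) * Ma) / Lg ^ k +
        2 * M' * Kline17 * Cd ^ 2 * (8 * M) / Lg ^ k := by
    rw [hWeq, ← hAC, show Res + 1 / (2 * (π : ℂ)) * Iline - frakAC χ =
      (Res - frakAC χ) + 1 / (2 * (π : ℂ)) * Iline by ring]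
    exact (norm_add_le _ _).trans (add_le_add hT2 hT3)
  have hre : |(W (fun n => divisorSumChar χ n ^ 2) X).re - frakA χ| ≤
      ‖W (fun n => divisorSumChar χ n ^ 2) X - (frakA χ : ℂ)‖ := by
    have := Complex.abs_re_le_norm (W (fun n => divisorSumChar χ n ^ 2) X - (frakA χ : ℂ))
    simpa using this
  set S : ℝ := ∑ n ∈ Finset.range (D ^ 4), ‖divisorSumChar χ n‖ ^ 2 / n
  set Wr : ℝ := (W (fun n => divisorSumChar χ n ^ 2) X).re
  calc |S - frakA χ| = |(S - Wr) + (Wr - frakA χ)| := by ring_nf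
    _ ≤ |S - Wr| + |Wr - frakA χ| := abs_add_le _ _
    _ ≤ (C31 / Lg ^ k + 1154 * Cd ^ 2 * (8 * M) / Lg ^ k) +
        ((32 * Ma + 32 * Real.exp (9 / 2) * Ma) / Lg ^ k +
          2 * M' * Kline17 * Cd ^ 2 * (8 * M) / Lg ^ k) := add_le_add hT1 (hre.trans hWn)
    _ = _ := by rw [hLdef, hM']; ring

/-- **Lemma 17.1 with the exponent free, complex form** (`ν(n)² = |ν(n)|²`, `L′(1,χ) ∈ ℝ` for quadratic `χ`):
`‖∑_{n<D⁴} ν(n)²/n − (6/π²)L′(1,χ)²∏_{q∣D} q/(q+1)‖ ≤ C𝓛^{−k}` from `‖L(1,χ)‖ ≤ 𝓛^{−(k+5)}`, `log D ≥ 3`.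
[cite: Zhang2022LandauSiegel, §17, Lemma 17.1] -/
theorem lemma171_scale_complex (k : ℕ) :
    ∃ C : ℝ, ∀ (D : ℕ) [NeZero D] (χ : DirichletCharacter ℂ D),
    χ.IsPrimitive → χ ^ 2 = 1 → 3 ≤ Real.log D →
    ‖χ.LFunction 1‖ ≤ 1 / Real.log D ^ (k + 5) →
      ‖∑ n ∈ Finset.range (D ^ 4), divisorSumChar χ n ^ 2 / (n : ℂ) - frakAC χ‖ ≤
        C / Real.log D ^ k := by
  obtain ⟨C, hC⟩ := lemma171_scale_of_norm_le k
  refine ⟨C, fun D _ χ hprim hχ2 hL hA => ?_⟩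
  have h := hC D χ hprim hχ2 hL hA
  have hq2 : 2 ≤ D := by
    rcases Nat.lt_or_ge D 2 with h' | h'
    · interval_cases D <;> norm_num at hL
    · exact h'
  have hχ1 := ne_one_of_isPrimitive χ hq2 hprim
  have hsum : ∑ n ∈ Finset.range (D ^ 4), divisorSumChar χ n ^ 2 / (n : ℂ) =
      ((∑ n ∈ Finset.range (D ^ 4), ‖divisorSumChar χ n‖ ^ 2 / n : ℝ) : ℂ) := by
    push_cast
    refine Finset.sum_congr rfl fun n _ => ?_
    rw [divisorSumChar_sq_eq χ hχ2 n]
    push_cast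
    rfl
  rw [hsum, frakAC_eq χ hχ1 hχ2, ← ofReal_sub, Complex.norm_real, Real.norm_eq_abs]
  exact h

/-! ## From `AssumptionAWith E`, every real `E ≥ k + 5`; the `Skeleton`-shaped eventual statement -/

/-- **Lemma 17.1 with the exponent free, from `AssumptionAWith E`** for every real `E ≥ k + 5`:
`|∑_{n<D⁴} |ν(n)|²/n − 𝔞| ≤ C𝓛^{−k}` for `log D ≥ 3`, `χ` primitive with `χ² = 1`.
[cite: Zhang2022LandauSiegel, §17, Lemma 17.1] -/
theorem lemma171_scale_of_assumptionAWith (k : ℕ) {E : ℝ} (hE : ((k + 5 : ℕ) : ℝ) ≤ E) :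
    ∃ C : ℝ, ∀ (D : ℕ) [NeZero D] (χ : DirichletCharacter ℂ D),
    χ.IsPrimitive → χ ^ 2 = 1 → 3 ≤ Real.log D → AssumptionAWith E D χ →
      |∑ n ∈ Finset.range (D ^ 4), ‖divisorSumChar χ n‖ ^ 2 / n - frakA χ| ≤
        C / Real.log D ^ k := by
  obtain ⟨C, hC⟩ := lemma171_scale_of_norm_le k
  exact ⟨C, fun D _ χ hprim hχ2 hL hA =>
    hC D χ hprim hχ2 hL (norm_le_pow_of_assumptionAWith χ (by linarith) hE hA)⟩

/-- **The eventual, `Skeleton`-shaped statement at rate `k`**: for every natural `k` and real `E ≥ k + 5` there is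
`C` with, for all large `D` and every real primitive `χ` mod `D`, `AssumptionAWith E D χ →
|∑_{n<D⁴} ‖ν(n)‖²/n − 𝔞| ≤ C/ell D^{k}` (`Skeleton.nu`, `Skeleton.ell`, `Skeleton.frakA`; the typed node
`Skeleton.AppBLemma171` is the rate `k = 2011` under the printed (A), cf. `Skeleton.appBLemma171_holds`).
[cite: Zhang2022LandauSiegel, §17, Lemma 17.1] -/
theorem appBLemma171_rate_of_assumptionAWith (k : ℕ) {E : ℝ} (hE : ((k + 5 : ℕ) : ℝ) ≤ E) :
    ∃ C : ℝ, Skeleton.ForAllLarge fun D _ χ => AssumptionAWith E D χ →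
      |∑ n ∈ Finset.range (D ^ 4), ‖Skeleton.nu χ n‖ ^ 2 / n - Skeleton.frakA χ| ≤
        C / Skeleton.ell D ^ k := by
  obtain ⟨C, hC⟩ := lemma171_scale_of_assumptionAWith k hE
  refine ⟨C, ⌈Real.exp 3⌉₊, fun D _ χ hD hq hp hA => ?_⟩
  have hlog : 3 ≤ Real.log D := by
    have h : Real.exp 3 ≤ D := le_trans (Nat.le_ceil _) (by exact_mod_cast hD)
    exact (Real.le_log_iff_exp_le (lt_of_lt_of_le (Real.exp_pos _) h)).mpr h
  simpa [Skeleton.nu, Skeleton.ell, Skeleton.frakA] using hC D χ hp hq.sq_eq_one hlog hA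

end Literature.NumberTheory.LFunctions.Zhang2022.Repair.Gap

end
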